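import Mathlib
import Summits.Ventures.FusionMHD.Models.CerfonFreidbergIterLikeQHalfMercDefs
import HarnessLib

/-!
# Ventures/FusionMHD — Models/CerfonFreidbergIterLikeQHalfMercPanels5.lean: KERNEL CHECK of the Mercier-register certificates of panel(s) 6, 7 (of 32)
# at `ψ_N = 1/2` of THE Cerfon–Freidberg ITER-like instance

HONEST FRAMING (LADDER-GRIDFUSION three columns; CF rung; «F2.R2-CF-MERCIER-IMPLICIT» step (2), F2-SCOPING v1.6 §10(c)).  One `decide +kernel` (≈ 100 s): for each
listed panel the obligation `CFIterLike.QHalfMerc.MercCert.ok` (`Models/CerfonFreidbergIterLikeQHalfMercDefs.lean`) — the Taylor-model run of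
`progM = progA ++ block1 ++ block2 ++ block3M` over ★ #117's parameter box is ACCEPTED (both `inv` certificates included) and the kernel's FOUR panel-integral
enclosures (`g_W`, `g_Aσ`, `g_AR`, `g_B1` along the approximant) lie inside the claimed integers (read off a compiled `#eval` of the same functions, slack one unit of
`2⁻⁶⁰`; float truth inside every panel, `HOME/models/model-7/g7/genqm/truthM.json`).  MODELLED: analytic Cerfon–Freidberg family; nothing about a device or
stability.  No `native_decide`.  Typer/prover: gridfusion-model-7 (g7), 2026-08-27.
Citations: Jardin 2010 §8.5 (8.134) [Jardin2010]; Mahboubi–Melquiond–Sibut-Pinote 2016 §3.2 Lemma 3 [MahboubiMelquiondSibutpinote2016].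
-/

namespace Summit.Ventures.FusionMHD.Models.CFIterLike.QHalfMerc

/-- Mercier-register certificate data of panel(s) 6, 7. [instance data] -/
def mercCert5 : List MercCert := [
  { j := 6, cand1 := [126743900120210931712, 380833473018928562176, 1666882981515048255488, 4779887472754209849344, 14876079706830249394176, 40114630039015809613824, 105123249502923612225536, 250235918450350190755840, 232830255899480422350848, -1885310705121875168591872, 1046956547654696253637263360, 5454542091213651164312633344, -1262110342642620776310485549056],
    cand2 := [140702960883855409152, 271388716073036480512, 1188284140132528553984, 3469996211904075268096, 11242118064341717614592, 31974125985622445260800, 89104911062398247370752, 231674882415974535921664, 693603549213226916904960, 5968490420922929733697536, -547386804145225684513456128, -6773942464320943401862168576, 927426109802073117470845042688],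
    deg := 10, e1 := 42, e2 := 42, wlo := -538271001238479012, whi := -538270888457680945, slo := 4580308684498590334, shi := 4580308993935061445,
    rlo := 6852627083628882513, rhi := 6852627556726034422, blo := 3061524061723283159, bhi := 3061524266471246402 },
  { j := 7, cand1 := [140434120266580410368, 501045001336953044992, 2216079086867641794560, 7104626892502204416000, 22991297996876188483584, 66026426889737410183168, 177975872168225973207040, 435062914464377487753216, 844036306372175310356480, -8818286479686622657904640, 303221231164222683962408960, 16731373321909618361149423616, -332415501646916375004152070144],
    cand2 := [150461952433914511360, 357364873123426205696, 1590663105860603478016, 5250767401134828027904, 17837164812596626325504, 54654538391082468638720, 160478928844752752214016, 446039405837738789830656, 749548054430011889811456, -9319581023398861698236416, 1332165936372729158087737344, 16927403803660120066560622592, -1604223857064749171020927074304],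
    deg := 10, e1 := 42, e2 := 42, wlo := -643907613906292103, whi := -643907493752061106, slo := 4999172473492036830, shi := 4999172790329255537,
    rlo := 7379364365257388596, rhi := 7379364843948097633, blo := 3386766455897700510, bhi := 3386766668601653273 }]

/-- **KERNEL CHECK** of the four Mercier registers on panel(s) 6, 7. -/
theorem mercCert5_ok : CFIterLike.QHalfMerc.mercCert5.all MercCert.ok = true := by
  decide +kernel

end Summit.Ventures.FusionMHD.Models.CFIterLike.QHalfMerc
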